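import Literature.RepresentationTheory.HeisenbergGroup.SymplecticDarbouxMover
import Literature.NumberTheory.Automorphic.LocalSchwartzBruhatDirectSum
import HarnessLib

/-!
# Skew square-zero nilpotents in `Sp(X × Y)`: conjugation bookkeeping, and coordinates along a splitting `ι₁ ⊕ ι₂ ≃ ι`
# (lemmas for the polarisation mover of two root families, piece P4-FINAL of the support-form proof of
# `rankOne_theta_lines_disjoint`)

Topic `RepresentationTheory/HeisenbergGroup`; namespace `Literature.RepresentationTheory.HeisenbergGroup`.  THEOREMS ONLY
(no definition, no named fact, no `sorry`).  Pure (symplectic) linear algebra.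

Currency of the tree (`SchrodingerSiegelParabolic`, `SchrodingerSymplecticGenerators`, `SymplecticDarbouxMover`):
`W = X × Y`, the commutator form `alt (polar β)` of a duality `β : X →ₗ Y →ₗ R`, `Sp = symplecticGroup (polar β)`, Siegel
unipotents `unipotentSp β b hb : (x, y) ↦ (x, y + b x)`; in coordinates `X = Y = K^ι`, `β_A(x, y) = x ⬝ (A y)`
(`Matrix.toLinearMap₂' K A`, `det A` a unit) and a splitting `e : ι₁ ⊕ ι₂ ≃ ι` (`resL`, `resR`, `glue` of
`LocalSchwartzBruhatDirectSum`: `v|₁`, `v|₂`, `a ⊔ b`).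

* §1 generic bookkeeping for a NILPOTENT `𝔫` which is skew for `alt (polar β)` with `𝔫² = 0`: its image is isotropic
  (`isotropic_range_of_skew_sq`), `1 + 𝔫 ∈ Sp` (`exists_symplecticGroup_apply_eq_add`), the conjugate
  `g (1 + N) g⁻¹ = 1 + g N g⁻¹` (`coe_conj_apply_of_apply_eq_add`), skewness and the anisotropy-mod-kernel condition
  `A(w, 𝔫 w) = 0 ⇒ 𝔫 w = 0` are transported by `g ∈ Sp` (`conj_skew`, `conj_apply_eq_zero_of_alt_self`), `ker N ⊇ (im N)ᗮ`
  for skew `N` (`apply_eq_zero_of_forall_alt`), and the FAMILY version of the recognition of Siegel unipotents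
  (`SiegelUnipotentOfIsotropicImage`): `g (1 + 𝔫) g⁻¹ = n(c₀)` forces `g 𝔫 g⁻¹ (x, y) = (0, c₀ x)` and
  `g (1 + t𝔫) g⁻¹ = n(t • c₀)` for every `u ∈ Sp` acting as `1 + t𝔫` (`conj_apply_nil_of_conj_eq_unipotentSp`,
  `conj_eq_unipotentSp_smul`).
* §2 coordinates along `e`: `v ⬝ w = v|₁ ⬝ w|₁ + v|₂ ⬝ w|₂` and its corollaries, the bundled `ξ ↦ ξ ⊔ 0`, the standard pair
  `X₁ = {x | x|₂ = 0}`, `Y₁ = {y | (A y)|₂ = 0}` (perfect pairing under `β_A`, `dim Y₁ = |ι₁|`: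
  `eq_zero_of_resR_eq_zero_of_forall`, `eq_zero_of_resR_mulVec_eq_zero_of_forall`, `finrank_ker_resR_mulVec`),
  non-degeneracy of `alt (polar β_A)` (`nondegenerate_alt_polar_toLinearMap₂'`), and the `ι₁`-SUPPORT CRITERION for
  second-degree data: `(A (c x))|₂ = 0 ∀ x` and `c` killing `{x | x|₁ = 0}` give `β_A(x, c x) = β_A(x̃, c x̃)`,
  `x̃ = x|₁ ⊔ 0` (`toLinearMap₂'_self_eq_of_support`).

[MoeglinVignerasWaldspurger1987, Chap. 2 II.6] [Weil1964, n° 5–6].  Use (cell hodgecm-mathlib, row IV-4(c1), P4-FINAL):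
consumed by `PolarisationMoverTwoRootFamilies.exists_mover_two_rootFamilies`.

## References
* [MoeglinVignerasWaldspurger1987] C. Mœglin, M.-F. Vignéras, J.-L. Waldspurger, *Correspondances de Howe sur un corps
  p-adique*, LNM 1291 (1987), Chap. 2 II.6.
* [Weil1964] A. Weil, *Sur certains groupes d'opérateurs unitaires*, Acta Math. 111 (1964), n° 5–6, pp. 150–151.
-/

set_option autoImplicit false

namespace Literature.RepresentationTheory.HeisenbergGroup

open Matrix Literature.NumberTheory.Automorphic

/-! ## §1 Generic bookkeeping for skew square-zero nilpotents in `Sp(X × Y)` -/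

section Generic

variable {R : Type*} [CommRing R] [Invertible (2 : R)] {X Y : Type*} [AddCommGroup X] [Module R X] [AddCommGroup Y]
  [Module R Y] (β : X →ₗ[R] Y →ₗ[R] R)

omit [Invertible (2 : R)] in
/-- the image of a skew square-zero nilpotent is isotropic: `A(𝔫 v, 𝔫 w) = -A(v, 𝔫² w) = 0`. [cite: Weil1964, n° 5, p. 150] -/
theorem isotropic_range_of_skew_sq (𝔫 : (X × Y) →ₗ[R] (X × Y))
    (hskew : ∀ v w, alt (polar β) (𝔫 v) w = -alt (polar β) v (𝔫 w)) (hsq : 𝔫 ∘ₗ 𝔫 = 0) :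
    ∀ p ∈ LinearMap.range 𝔫, ∀ q ∈ LinearMap.range 𝔫, alt (polar β) p q = 0 := by
  rintro _ ⟨v, rfl⟩ _ ⟨w, rfl⟩
  have h0 : 𝔫 (𝔫 w) = 0 := by rw [← LinearMap.comp_apply, hsq, LinearMap.zero_apply]
  rw [hskew, h0, map_zero, neg_zero]

omit [Invertible (2 : R)] in
/-- **`1 + 𝔫 ∈ Sp(X × Y)`** for `𝔫` skew and square-zero (inverse `1 - 𝔫`): the unipotent root element with derivative `𝔫`.
[cite: Weil1964, n° 5, p. 150] -/
theorem exists_symplecticGroup_apply_eq_add (𝔫 : (X × Y) →ₗ[R] (X × Y))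
    (hskew : ∀ v w, alt (polar β) (𝔫 v) w = -alt (polar β) v (𝔫 w)) (hsq : 𝔫 ∘ₗ 𝔫 = 0) :
    ∃ u : symplecticGroup (polar β), ∀ w, (u : (X × Y) ≃ₗ[R] (X × Y)) w = w + 𝔫 w := by
  have h0 : ∀ w, 𝔫 (𝔫 w) = 0 := fun w => by rw [← LinearMap.comp_apply, hsq, LinearMap.zero_apply]
  have h1 : (LinearMap.id + 𝔫) ∘ₗ (LinearMap.id - 𝔫) = LinearMap.id := LinearMap.ext fun w => by simp [h0]
  have h2 : (LinearMap.id - 𝔫) ∘ₗ (LinearMap.id + 𝔫) = LinearMap.id := LinearMap.ext fun w => by simp [h0]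
  have hmem : LinearEquiv.ofLinear (LinearMap.id + 𝔫) (LinearMap.id - 𝔫) h1 h2 ∈ symplecticGroup (polar β) := by
    rw [mem_symplecticGroup]
    intro w w'
    rw [← alt_apply, ← alt_apply]
    simp only [LinearEquiv.ofLinear_apply, LinearMap.add_apply, LinearMap.id_apply, map_add, hskew, h0, map_zero,
      neg_zero, add_zero]
    abel
  exact ⟨⟨_, hmem⟩, fun w => rfl⟩

omit [Invertible (2 : R)] in
/-- **`g (1 + N) g⁻¹ = 1 + g N g⁻¹`** on vectors, for `u ∈ Sp` acting as `w ↦ w + N w`. [cite: Weil1964, n° 5, p. 150] -/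
theorem coe_conj_apply_of_apply_eq_add (g u : symplecticGroup (polar β)) (N : (X × Y) →ₗ[R] (X × Y))
    (hu : ∀ w, (u : (X × Y) ≃ₗ[R] (X × Y)) w = w + N w) (w : X × Y) :
    ((g * u * g⁻¹ : symplecticGroup (polar β)) : (X × Y) ≃ₗ[R] (X × Y)) w =
      w + (g : (X × Y) ≃ₗ[R] (X × Y)) (N ((g : (X × Y) ≃ₗ[R] (X × Y)).symm w)) := by
  change (g : (X × Y) ≃ₗ[R] (X × Y)) ((u : (X × Y) ≃ₗ[R] (X × Y)) ((g : (X × Y) ≃ₗ[R] (X × Y)).symm w)) = _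
  rw [hu, map_add, LinearEquiv.apply_symm_apply]

omit [Invertible (2 : R)] in
/-- **skewness is transported by `g ∈ Sp`**: `A(g N g⁻¹ p, q) = -A(p, g N g⁻¹ q)`. [cite: Weil1964, n° 5, p. 150] -/
theorem conj_skew (g : symplecticGroup (polar β)) {N : (X × Y) →ₗ[R] (X × Y)}
    (hskew : ∀ v w, alt (polar β) (N v) w = -alt (polar β) v (N w)) (p q : X × Y) :
    alt (polar β) ((g : (X × Y) ≃ₗ[R] (X × Y)) (N ((g : (X × Y) ≃ₗ[R] (X × Y)).symm p))) q =
      -alt (polar β) p ((g : (X × Y) ≃ₗ[R] (X × Y)) (N ((g : (X × Y) ≃ₗ[R] (X × Y)).symm q))) := by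
  have hgA : ∀ v w, alt (polar β) ((g : (X × Y) ≃ₗ[R] (X × Y)) v) ((g : (X × Y) ≃ₗ[R] (X × Y)) w) = alt (polar β) v w :=
    (Heisenberg.PseudoSymplectic.mem_isometries (alt (polar β)) _).1 g.2
  conv_lhs => rw [← (g : (X × Y) ≃ₗ[R] (X × Y)).apply_symm_apply q, hgA, hskew]
  rw [← hgA ((g : (X × Y) ≃ₗ[R] (X × Y)).symm p) (N ((g : (X × Y) ≃ₗ[R] (X × Y)).symm q)),
    LinearEquiv.apply_symm_apply]

omit [Invertible (2 : R)] in
/-- **anisotropy modulo the kernel is transported by `g ∈ Sp`**: if `A(w, 𝔫 w) = 0 ⇒ 𝔫 w = 0` then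
`A(p, g 𝔫 g⁻¹ p) = 0 ⇒ g 𝔫 g⁻¹ p = 0`. [cite: MoeglinVignerasWaldspurger1987, Chap. 2 II.6] -/
theorem conj_apply_eq_zero_of_alt_self (g : symplecticGroup (polar β)) {N : (X × Y) →ₗ[R] (X × Y)}
    (han : ∀ w, alt (polar β) w (N w) = 0 → N w = 0) (p : X × Y)
    (h : alt (polar β) p ((g : (X × Y) ≃ₗ[R] (X × Y)) (N ((g : (X × Y) ≃ₗ[R] (X × Y)).symm p))) = 0) :
    (g : (X × Y) ≃ₗ[R] (X × Y)) (N ((g : (X × Y) ≃ₗ[R] (X × Y)).symm p)) = 0 := by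
  have hgA : ∀ v w, alt (polar β) ((g : (X × Y) ≃ₗ[R] (X × Y)) v) ((g : (X × Y) ≃ₗ[R] (X × Y)) w) = alt (polar β) v w :=
    (Heisenberg.PseudoSymplectic.mem_isometries (alt (polar β)) _).1 g.2
  have h' : alt (polar β) ((g : (X × Y) ≃ₗ[R] (X × Y)).symm p) (N ((g : (X × Y) ≃ₗ[R] (X × Y)).symm p)) = 0 := by
    rwa [← hgA, LinearEquiv.apply_symm_apply]
  rw [han _ h', map_zero]

omit [Invertible (2 : R)] in
/-- **`ker N ⊇ (im N)ᗮ` for skew `N`** (`A` non-degenerate): `A(p, N q) = 0 ∀ q` forces `N p = 0`. [cite: Weil1964, n° 5, p. 150] -/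
theorem apply_eq_zero_of_forall_alt (hN : (alt (polar β)).Nondegenerate) {N : (X × Y) →ₗ[R] (X × Y)}
    (hskew : ∀ v w, alt (polar β) (N v) w = -alt (polar β) v (N w)) (p : X × Y)
    (h : ∀ q, alt (polar β) p (N q) = 0) : N p = 0 :=
  hN.1 _ fun q => by rw [hskew, h, neg_zero]

/-- **the derivative read off from the recognition**: if `u₁ = 1 + 𝔫` and `g u₁ g⁻¹ = n(c₀)` then `g 𝔫 g⁻¹ (x, y) = (0, c₀ x)`.
[cite: Weil1964, n° 6, p. 151] -/
theorem conj_apply_nil_of_conj_eq_unipotentSp (g u₁ : symplecticGroup (polar β)) (𝔫 : (X × Y) →ₗ[R] (X × Y))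
    (hu₁ : ∀ w, (u₁ : (X × Y) ≃ₗ[R] (X × Y)) w = w + 𝔫 w) (c₀ : X →ₗ[R] Y)
    (hc₀ : ∀ x x', β x (c₀ x') = β x' (c₀ x)) (h : g * u₁ * g⁻¹ = unipotentSp β c₀ hc₀) (w : X × Y) :
    (g : (X × Y) ≃ₗ[R] (X × Y)) (𝔫 ((g : (X × Y) ≃ₗ[R] (X × Y)).symm w)) = (0, c₀ w.1) := by
  have h1 := congrArg (fun s : symplecticGroup (polar β) => (s : (X × Y) ≃ₗ[R] (X × Y)) w) h
  rw [coe_conj_apply_of_apply_eq_add β g u₁ 𝔫 hu₁, coe_unipotentSp, unipotentσ_apply] at h1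
  calc (g : (X × Y) ≃ₗ[R] (X × Y)) (𝔫 ((g : (X × Y) ≃ₗ[R] (X × Y)).symm w))
      = (w + (g : (X × Y) ≃ₗ[R] (X × Y)) (𝔫 ((g : (X × Y) ≃ₗ[R] (X × Y)).symm w))) - w := by rw [add_sub_cancel_left]
    _ = (w.1, w.2 + c₀ w.1) - w := by rw [h1]
    _ = (0, c₀ w.1) := by ext <;> simp

/-- **the FAMILY version of the recognition**: if `g (1 + 𝔫) g⁻¹ = n(c₀)` then every `u ∈ Sp` acting as `1 + t𝔫` has
`g u g⁻¹ = n(t • c₀)` (linearity of `t ↦ g t𝔫 g⁻¹`). [cite: Weil1964, n° 6, p. 151] [cite: MoeglinVignerasWaldspurger1987, Chap. 2 II.6] -/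
theorem conj_eq_unipotentSp_smul (g u₁ : symplecticGroup (polar β)) (𝔫 : (X × Y) →ₗ[R] (X × Y))
    (hu₁ : ∀ w, (u₁ : (X × Y) ≃ₗ[R] (X × Y)) w = w + 𝔫 w) (c₀ : X →ₗ[R] Y)
    (hc₀ : ∀ x x', β x (c₀ x') = β x' (c₀ x)) (h : g * u₁ * g⁻¹ = unipotentSp β c₀ hc₀) (t : R)
    (u : symplecticGroup (polar β)) (hu : ∀ w, (u : (X × Y) ≃ₗ[R] (X × Y)) w = w + t • 𝔫 w)
    (ht : ∀ x x', β x ((t • c₀) x') = β x' ((t • c₀) x)) :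
    g * u * g⁻¹ = unipotentSp β (t • c₀) ht := by
  refine Subtype.ext (LinearEquiv.ext fun w => ?_)
  rw [coe_unipotentSp, unipotentσ_apply,
    coe_conj_apply_of_apply_eq_add β g u (t • 𝔫) (fun w => by rw [hu, LinearMap.smul_apply]) w,
    LinearMap.smul_apply, map_smul, conj_apply_nil_of_conj_eq_unipotentSp β g u₁ 𝔫 hu₁ c₀ hc₀ h w]
  ext <;> simp

end Generic

/-! ## §2 Coordinates along a splitting `e : ι₁ ⊕ ι₂ ≃ ι` -/

section Coordinates

variable {K : Type*} [Field K] {ι₁ ι₂ ι : Type*} [Fintype ι₁] [Fintype ι₂] [Fintype ι] [DecidableEq ι₁]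
  [DecidableEq ι₂] [DecidableEq ι] (e : ι₁ ⊕ ι₂ ≃ ι)

omit [DecidableEq ι₁] [DecidableEq ι₂] [DecidableEq ι] in
/-- `v ⬝ w = v|₁ ⬝ w|₁ + v|₂ ⬝ w|₂`. [cite: Weil1964, n° 5, p. 150] -/
theorem dotProduct_eq_resL_add_resR (v w : ι → K) : v ⬝ᵥ w = resL e v ⬝ᵥ resL e w + resR e v ⬝ᵥ resR e w := by
  simp only [dotProduct]
  rw [← e.sum_comp, Fintype.sum_sum_type]
  rfl

omit [DecidableEq ι₁] [DecidableEq ι₂] [DecidableEq ι] in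
/-- `(ξ ⊔ 0) ⬝ w = ξ ⬝ w|₁`. [cite: Weil1964, n° 5, p. 150] -/
theorem glue_zero_dotProduct (ξ : ι₁ → K) (w : ι → K) : glue e ξ 0 ⬝ᵥ w = ξ ⬝ᵥ resL e w := by
  rw [dotProduct_eq_resL_add_resR e, resL_glue, resR_glue, zero_dotProduct, add_zero]

omit [DecidableEq ι₁] [DecidableEq ι₂] [DecidableEq ι] in
/-- `v ⬝ (ξ ⊔ 0) = v|₁ ⬝ ξ`. [cite: Weil1964, n° 5, p. 150] -/
theorem dotProduct_glue_zero (v : ι → K) (ξ : ι₁ → K) : v ⬝ᵥ glue e ξ 0 = resL e v ⬝ᵥ ξ := by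
  rw [dotProduct_eq_resL_add_resR e, resL_glue, resR_glue, dotProduct_zero, add_zero]

omit [DecidableEq ι₁] [DecidableEq ι₂] [DecidableEq ι] in
/-- `v ⬝ w = v|₁ ⬝ w|₁` when `w|₂ = 0`. [cite: Weil1964, n° 5, p. 150] -/
theorem dotProduct_of_resR_eq_zero (v : ι → K) {w : ι → K} (hw : resR e w = 0) :
    v ⬝ᵥ w = resL e v ⬝ᵥ resL e w := by
  rw [dotProduct_eq_resL_add_resR e, hw, dotProduct_zero, add_zero]

omit [DecidableEq ι₁] [DecidableEq ι₂] [DecidableEq ι] in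
/-- `v ⬝ w = v|₁ ⬝ w|₁` when `v|₂ = 0`. [cite: Weil1964, n° 5, p. 150] -/
theorem dotProduct_of_resR_eq_zero_left {v : ι → K} (hv : resR e v = 0) (w : ι → K) :
    v ⬝ᵥ w = resL e v ⬝ᵥ resL e w := by
  rw [dotProduct_eq_resL_add_resR e, hv, zero_dotProduct, add_zero]

omit [Fintype ι₁] [Fintype ι₂] [Fintype ι] [DecidableEq ι₁] [DecidableEq ι₂] [DecidableEq ι] in
/-- `w = w|₁ ⊔ 0` when `w|₂ = 0`. [cite: Weil1964, n° 5, p. 150] -/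
theorem eq_glue_resL_of_resR_eq_zero {w : ι → K} (hw : resR e w = 0) : w = glue e (resL e w) 0 := by
  conv_lhs => rw [← glue_resL_resR e w]
  rw [hw]

omit [Fintype ι₂] [Fintype ι] [DecidableEq ι₂] [DecidableEq ι] in
/-- `η ⬝ ξ = 0` for all `η` forces `ξ = 0`. [cite: Weil1964, n° 5, p. 150] -/
theorem eq_zero_of_forall_dotProduct_eq_zero (ξ : ι₁ → K) (h : ∀ η : ι₁ → K, η ⬝ᵥ ξ = 0) : ξ = 0 := by
  funext i
  have := h (Pi.single i 1)
  rwa [single_one_dotProduct] at this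

omit [Fintype ι₁] [Fintype ι₂] [Fintype ι] [DecidableEq ι₁] [DecidableEq ι₂] [DecidableEq ι] in
/-- `t • (a ⊔ b) = (t • a) ⊔ (t • b)`. [cite: Weil1964, n° 5, p. 150] -/
theorem smul_glue₁₂ (t : K) (a : ι₁ → K) (b : ι₂ → K) : t • glue e a b = glue e (t • a) (t • b) := by
  funext k
  obtain ⟨s, rfl⟩ := e.surjective k
  rcases s with i | j
  · rw [Pi.smul_apply, glue_apply_inl, glue_apply_inl, Pi.smul_apply]
  · rw [Pi.smul_apply, glue_apply_inr, glue_apply_inr, Pi.smul_apply]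

omit [Fintype ι₁] [Fintype ι₂] [Fintype ι] [DecidableEq ι₁] [DecidableEq ι₂] [DecidableEq ι] in
/-- `(x - x|₁ ⊔ 0)|₁ = 0`. [cite: Weil1964, n° 5, p. 150] -/
theorem resL_sub_glue (x : ι → K) : resL e (x - glue e (resL e x) 0) = 0 := by
  rw [resL_sub, resL_glue, sub_self]

omit [Fintype ι₁] [Fintype ι₂] [Fintype ι] [DecidableEq ι₁] [DecidableEq ι₂] [DecidableEq ι] in
/-- the bundled linear map `ξ ↦ ξ ⊔ 0 : K^{ι₁} → K^ι`. [cite: Weil1964, n° 5, p. 150] -/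
theorem exists_linearMap_glue_zero : ∃ gl : (ι₁ → K) →ₗ[K] (ι → K), ∀ ξ, gl ξ = glue e ξ 0 :=
  ⟨{ toFun := fun ξ => glue e ξ 0
     map_add' := fun a b => by
       show glue e (a + b) 0 = glue e a 0 + glue e b 0
       rw [glue_add, add_zero]
     map_smul' := fun t a => by
       show glue e (t • a) 0 = t • glue e a 0
       rw [smul_glue₁₂, smul_zero] }, fun _ => rfl⟩

variable (A : Matrix ι ι K) (hA : IsUnit A.det)

omit [Fintype ι₁] [Fintype ι₂] [DecidableEq ι₁] [DecidableEq ι₂] in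
include hA in
/-- `(A A⁻¹ (η ⊔ 0))|₂ = 0`: the vectors `A⁻¹(η ⊔ 0)` lie in `Y₁ = {y | (A y)|₂ = 0}`. [cite: Weil1964, n° 5, p. 150] -/
theorem resR_mulVec_inv_mulVec_glue_zero (η : ι₁ → K) : resR e (A *ᵥ (A⁻¹ *ᵥ glue e η 0)) = 0 := by
  rw [Matrix.mulVec_mulVec, Matrix.mul_nonsing_inv A hA, Matrix.one_mulVec, resR_glue]

omit [DecidableEq ι₂] in
include hA in
/-- **duality of the standard pair, first half**: `x ∈ X₁ = {x | x|₂ = 0}` with `x ⬝ A y = 0` for all `y ∈ Y₁ = {y | (A y)|₂ = 0}`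
is `0`. [cite: Weil1964, n° 5, p. 150] -/
theorem eq_zero_of_resR_eq_zero_of_forall (x : ι → K) (hx : resR e x = 0)
    (h : ∀ y : ι → K, resR e (A *ᵥ y) = 0 → x ⬝ᵥ (A *ᵥ y) = 0) : x = 0 := by
  have hL : resL e x = 0 := by
    refine eq_zero_of_forall_dotProduct_eq_zero (resL e x) fun η => ?_
    have := h (A⁻¹ *ᵥ glue e η 0) (resR_mulVec_inv_mulVec_glue_zero e A hA η)
    rw [Matrix.mulVec_mulVec, Matrix.mul_nonsing_inv A hA, Matrix.one_mulVec, dotProduct_glue_zero] at this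
    rwa [dotProduct_comm]
  rw [eq_glue_resL_of_resR_eq_zero e hx, hL, glue_zero]

omit [DecidableEq ι₂] in
include hA in
/-- **duality of the standard pair, second half**: `y ∈ Y₁` with `x ⬝ A y = 0` for all `x ∈ X₁` is `0`. [cite: Weil1964, n° 5, p. 150] -/
theorem eq_zero_of_resR_mulVec_eq_zero_of_forall (y : ι → K) (hy : resR e (A *ᵥ y) = 0)
    (h : ∀ x : ι → K, resR e x = 0 → x ⬝ᵥ (A *ᵥ y) = 0) : y = 0 := by
  have hL : resL e (A *ᵥ y) = 0 :=
    eq_zero_of_forall_dotProduct_eq_zero (resL e (A *ᵥ y)) fun η => by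
      have := h (glue e η 0) (resR_glue e η 0)
      rwa [glue_zero_dotProduct] at this
  have hAy : A *ᵥ y = 0 := by rw [eq_glue_resL_of_resR_eq_zero e hy, hL, glue_zero]
  exact (Matrix.mulVec_injective_iff_isUnit.2 ((Matrix.isUnit_iff_isUnit_det _).2 hA))
    (by rw [hAy, Matrix.mulVec_zero])

omit [DecidableEq ι₁] [DecidableEq ι₂] in
include hA in
/-- **`dim Y₁ = |ι₁|`** for `Y₁ = {y | (A y)|₂ = 0}` = the kernel of the surjection `y ↦ (A y)|₂ : K^ι → K^{ι₂}`.
[cite: Weil1964, n° 5, p. 150] -/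
theorem finrank_ker_resR_mulVec :
    Module.finrank K (LinearMap.ker (LinearMap.funLeft K K (fun j => e (Sum.inr j)) ∘ₗ Matrix.toLin' A)) =
      Fintype.card ι₁ := by
  have hsurj : Function.Surjective (LinearMap.funLeft K K (fun j => e (Sum.inr j)) ∘ₗ Matrix.toLin' A) := fun η =>
    ⟨A⁻¹ *ᵥ glue e 0 η, by
      funext j
      rw [LinearMap.comp_apply, Matrix.toLin'_apply, LinearMap.funLeft_apply, Matrix.mulVec_mulVec,
        Matrix.mul_nonsing_inv A hA, Matrix.one_mulVec, glue_apply_inr]⟩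
  have h1 := LinearMap.finrank_range_add_finrank_ker (LinearMap.funLeft K K (fun j => e (Sum.inr j)) ∘ₗ Matrix.toLin' A)
  rw [LinearMap.range_eq_top.2 hsurj, finrank_top, Module.finrank_fintype_fun_eq_card,
    Module.finrank_fintype_fun_eq_card, ← Fintype.card_congr e, Fintype.card_sum] at h1
  omega

omit [DecidableEq ι₁] [DecidableEq ι₂] in
include hA in
/-- **`alt (polar β_A)` is non-degenerate** for `det A` a unit. [cite: Weil1964, n° 5, p. 150] -/
theorem nondegenerate_alt_polar_toLinearMap₂' : (alt (polar (Matrix.toLinearMap₂' K A))).Nondegenerate :=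
  ⟨fun _ hp => eq_zero_of_forall_alt_polar_toLinearMap₂'_eq_zero A hA hp,
    fun q hq => eq_zero_of_forall_alt_polar_toLinearMap₂'_eq_zero A hA fun p => by
      rw [alt_polar_toLinearMap₂'_swap, hq, neg_zero]⟩

omit [DecidableEq ι₁] [DecidableEq ι₂] in
/-- **the `ι₁`-support criterion**: if `(A (c x))|₂ = 0` for all `x` and `c` kills `{x | x|₁ = 0}` then the second-degree datum
`β_A(x, c x)` depends only on `x|₁`: `β_A(x, c x) = β_A(x̃, c x̃)`, `x̃ = x|₁ ⊔ 0`. [cite: Weil1964, n° 13, p. 160] -/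
theorem toLinearMap₂'_self_eq_of_support (c : (ι → K) →ₗ[K] (ι → K)) (h8 : ∀ x, resR e (A *ᵥ c x) = 0)
    (h7 : ∀ x, resL e x = 0 → c x = 0) (x : ι → K) :
    Matrix.toLinearMap₂' K A x (c x) =
      Matrix.toLinearMap₂' K A (glue e (resL e x) 0) (c (glue e (resL e x) 0)) := by
  have hcx : c x = c (glue e (resL e x) 0) := by
    rw [← sub_eq_zero, ← map_sub]
    exact h7 _ (resL_sub_glue e x)
  rw [Matrix.toLinearMap₂'_apply', Matrix.toLinearMap₂'_apply', hcx, dotProduct_of_resR_eq_zero e x (h8 _),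
    dotProduct_of_resR_eq_zero e (glue e (resL e x) 0) (h8 _), resL_glue]

end Coordinates

end Literature.RepresentationTheory.HeisenbergGroup
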